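import Summits.QuantumFields.BalabanUV.Beta.FP.TorusHSideJetConjPeriodic
import Summits.QuantumFields.BalabanUV.Beta.FP.RelInvPeriodisedComb

/-!
# `BalabanUV.Beta.FP.TorusHSideJetConjLetters` — road «FP» for binder row D1, ROUTE T (β1), SPEC-48 §E (E3c):
# **THE TWO CONJUGATION LETTERS OF `TorusHSideJetConjPeriodic` DISCHARGED AT THE WRAPPER's TORUS HESSIAN KERNEL
# `K₀ := bhKStepSh d Lc (Dsh Lc) j` ON THE TOWER TORI — so that `H′₁f v = perF T (dper T 𝒴)` holds at the END wrapper's objects with NO letter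
# beyond g37's Λ-brick `LocStencil` display**

WHY.  `TorusHSideJetConjPeriodic.H'1f_eq_perF_dper(_boxLift)` (g38, SPEC-48 §E (E3b)) takes the torus Hessian kernel `K₀` with two letters: bi-invariance
under the period lattice `T ℤ^{d+1}` at the `ff` fibres (`hK₀`) and the `perZ` summability of its translates (`hK₀s`).  At the END wrapper
(`StepRecursionFeedNestedNamedB.d1Tel_JcComp_ctr_named`, binder `hH₀`) `K₀ = bhKStepSh 3 Lc (Dsh Lc) (n+1−(n+1))` and `T = towerTorus Lc (fine Lc (Mc B)) (n+1)`.
Both letters are ALREADY in the tree for this kernel, BY NAME: block covariance `RelInvPeriodisedComb.shiftK_bhKStepSh` (every level `j`) gives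
`T`-invariance for every `T` with `Lc ∣ T i` (`KernelPeriodisationFib.translate_invariant_of_shiftK`), and the spread `RelInvPeriodisedComb.spr_bhKStepSh_Dsh`
(= `∃ C δ, 0 < δ ∧ Decays`) gives the summability of translates (`KernelPeriodisationFib.summable_translate_of_decays`, `decays_abs`).  THIS FILE composes
them (§1 generic: any block-covariant spread kernel; §2 the instance on `towerTorus Lc M (n+1)`, whose moduli `Lc^{n+1}·M i` are multiples of `Lc`) and
restates (E3b) at the wrapper's `K₀` with the letters GONE (§3 `H'1f_eq_perF_dper_bhKStepSh`: any pre-image `λ̃`; `H'1f_eq_perF_dper_bhKStepSh_boxLift`: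
the canonical box lift — NO hypothesis beyond g37's display data `hℓ hLS hCs hδ h𝒦 h𝒱` and the displays `h𝒳 ∕ h𝒴`).

WHAT ([folklore] bookkeeping BY NAME; no `def`, no `def … : Prop`, nothing cited, 0 sorry): §1 `translate_invariant_of_blockCov`, `summable_translate_of_spr`;
§2 `dvd_towerTorus_succ`, `bhKStepSh_translate_invariant`, `summable_bhKStepSh_translate`; §3 **`H'1f_eq_perF_dper_bhKStepSh`**, **`H'1f_eq_perF_dper_bhKStepSh_boxLift`**.
WRAPPER DICTIONARY (instantiate): `d := 3`, `M := fine Lc (Mc B)`, depth `n := n` (the file's torus is `towerTorus Lc M (n+1)` = the wrapper's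
`towerTorus Lc (fine Lc (Mc B)) (n+1)` on the nose), `j := n+1−(n+1)`, `c := c n`, `l := lv n B v`, `w := w n`, `cf := cf n B`, `hb k := hb n B k v`,
`𝒽 μ y := symHessFFAt (toSite (ctrOff 4 Lc)) Lc μ y`, `lev i := n+1−i`, `rs _ := ctrOff 4 Lc`.
WHAT THIS IS NOT: not the identification of `𝒴` with the ff-block of an2's `VN (n+1) μ y` ((E4) ∕ (C1), the row's words); no row of the END wrapper discharged;
no estimate; nothing of Bałaban's asserted, valued or discharged; 0∕4 row-D1 binders (hW, hR, D1Tel, D1Rep); ROOT M‴ p325680 untouched; NOT (C1), NOT (L2′), NOT (T-ID),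
NOT SDF, NOT D1, NOT BetaPertH, NOT continuum, NOT Clay.

HONEST DEPENDENCY (page 1, mandatory): continuum YM on T⁴ ⇐ BetaPertH ∧ nine spine estimates (0/9 proved); BetaPertH ⇐ (D1) ∧ (D4) ∧ CAP+tail;
G-an2-4 gates asym, D1 and NE2/3/4.  HONEST FRAMING (cell contract, verbatim): «discharging `BetaPertH` makes Bałaban's UV stability UNCONDITIONAL —
a real constructive-QFT result; it is NOT the continuum limit and NOT the Clay problem.»  ABSOLUTE RULE (cell charter, verbatim): «No internally-minted
statement may enter as a cited fact. Every hypothesis is either kernel-proved in this package or a verbatim quotation of a PUBLISHED theorem with page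
reference. The manuscript(s) under audit are NOT citable for their own disputed steps — they are the thing under adjudication; programme-internal
(2001/route/tribunal) claims are never citable.»  Road «FP» OWNER, b2b-balaban-beta-d1-p3 gen 38, 2026-08-26.  No existing file touched.
-/

noncomputable section

open scoped BigOperators

namespace Summit.QuantumFields.BalabanUV.Beta.FP.TorusHSideJetConjLetters

open Finset Matrix
open Literature.MathematicalPhysics.QuantumFieldTheory.Balaban1983to89 Literature.MathematicalPhysics.QuantumFieldTheory.Balaban1983to89.Beta
open B4TorusKernel.MultiPeriod (translate)  open B6Lemma24Torus (pbox)
open AffineAveraging (Site)  open AveragingHessianKernels (Bond)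
open AveragingContoursRooted (ctr)  open ExpKernelCalculus (MKer Decays shiftK)  open OneStepResolventKernel (Fib LocStencil)  open InterLevelTransport (SLam)
open StepJetData (wilsonA)
open Summit.QuantumFields.BalabanUV.Beta.TameKernelCalculus (Spr)
open Summit.QuantumFields.BalabanUV.Beta.SymAveragingHessianCounts (symLinKerAt)  open Summit.QuantumFields.BalabanUV.Beta.BorderedHessian (stepScale)
open Summit.QuantumFields.BalabanUV.Beta.CompositeVertexKernelRec (compLinKer)
open Summit.QuantumFields.BalabanUV.Beta.SymShiftedSpread (bhKStepSh)  open Summit.QuantumFields.BalabanUV.Beta.DshAn1 (Dsh)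
open Summit.QuantumFields.BalabanUV.Beta.FP.RelInvPeriodisedComb (shiftK_bhKStepSh spr_bhKStepSh_Dsh)
open Summit.QuantumFields.BalabanUV.Beta.FP.KernelPeriodisationFib (Idx perF translate_invariant_of_shiftK summable_translate_of_decays decays_abs)
open Summit.QuantumFields.BalabanUV.Beta.FP.KernelPeriodisationFibLoc (dper)
open Summit.QuantumFields.BalabanUV.Beta.FP.TorusCompositeObjects (towerTorus towerTorus_apply)
open Summit.QuantumFields.BalabanUV.Beta.FP.TorusCompositeCompanionSumG (compSumSym)  open Summit.QuantumFields.BalabanUV.Beta.FP.TorusCompositeCompanionFamilyG (onTowerFamily)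
open Summit.QuantumFields.BalabanUV.Beta.FP.TorusHSideJetConjPeriodic (H'1f_eq_perF_dper H'1f_eq_perF_dper_boxLift)

variable {d : ℕ}

/-! ## §1 Generic: a block-covariant spread kernel meets the two conjugation letters on every admissible torus -/

section Generic

variable {Lc : ℕ} (T : Fin (d + 1) → ℕ) [∀ μ, NeZero (T μ)] (hT : ∀ i, Lc ∣ T i) {K : MKer (d + 1) (Fib d)}
include hT

omit [∀ μ, NeZero (T μ)] in
/-- [folklore] **block covariance at blocking `Lc` ⟹ bi-invariance under every period lattice `T ℤ^{d+1}` with `Lc ∣ T i`** (`translate_invariant_of_shiftK`),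
stated at the `ff` fibres (the `hK₀` letter of `TorusHSideJetConjPeriodic`). -/
theorem translate_invariant_of_blockCov (hK : ∀ t : Fin (d + 1) → ℤ, shiftK ((Lc : ℤ) • t) K = K) (m x y : Fin (d + 1) → ℤ) (a b : Fin (d + 1)) :
    K (translate T x m) (translate T y m) (Sum.inl a) (Sum.inl b) = K x y (Sum.inl a) (Sum.inl b) :=
  translate_invariant_of_shiftK T hK hT m x y (Sum.inl a) (Sum.inl b)

omit hT in
/-- [folklore] **a spread kernel (`Spr`: exponential decay at some positive rate) has summable `T`-translates** (`decays_abs` + `summable_translate_of_decays`)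
— the `hK₀s` letter of `TorusHSideJetConjPeriodic`, at the `ff` fibres. -/
theorem summable_translate_of_spr (hK : Spr K) (x y : Fin (d + 1) → ℤ) (a b : Fin (d + 1)) :
    Summable fun m : Fin (d + 1) → ℤ => K x (translate T y m) (Sum.inl a) (Sum.inl b) := by
  obtain ⟨C, δ, hδ, hD⟩ := hK
  exact summable_translate_of_decays (decays_abs hD) (abs_nonneg C) hδ (fun i => Nat.one_le_iff_ne_zero.mpr (NeZero.ne (T i))) x y (Sum.inl a) (Sum.inl b)

end Generic

/-! ## §2 The instance: `bhKStepSh d Lc (Dsh Lc) j` on the tower torus `towerTorus Lc M (n+1)` -/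

section Instance

variable (Lc : ℕ) [NeZero Lc] (M : Fin (d + 1) → ℕ) [∀ μ, NeZero (M μ)] (n j : ℕ)

omit [NeZero Lc] [∀ μ, NeZero (M μ)] in
/-- [folklore] the moduli of a tower torus of positive depth are multiples of the blocking: `Lc ∣ towerTorus Lc M (n+1) i = Lc^{n+1}·M i`. -/
theorem dvd_towerTorus_succ (i : Fin (d + 1)) : Lc ∣ towerTorus Lc M (n + 1) i := by
  rw [towerTorus_apply, pow_succ]
  exact Dvd.dvd.mul_right (Dvd.intro_left _ rfl) _

omit [∀ μ, NeZero (M μ)] in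
/-- [folklore] **`hK₀` AT THE WRAPPER's KERNEL**: `bhKStepSh d Lc (Dsh Lc) j` is bi-invariant under `towerTorus Lc M (n+1) ℤ^{d+1}` at the `ff` fibres
(`RelInvPeriodisedComb.shiftK_bhKStepSh`, every level `j`). -/
theorem bhKStepSh_translate_invariant (m x y : Fin (d + 1) → ℤ) (a b : Fin (d + 1)) :
    bhKStepSh d Lc (Dsh Lc) j (translate (towerTorus Lc M (n + 1)) x m) (translate (towerTorus Lc M (n + 1)) y m) (Sum.inl a) (Sum.inl b)
      = bhKStepSh d Lc (Dsh Lc) j x y (Sum.inl a) (Sum.inl b) :=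
  translate_invariant_of_blockCov (towerTorus Lc M (n + 1)) (dvd_towerTorus_succ Lc M n) (fun t => shiftK_bhKStepSh t j) m x y a b

/-- [folklore] **`hK₀s` AT THE WRAPPER's KERNEL**: the `towerTorus Lc M (n+1)`-translates of `bhKStepSh d Lc (Dsh Lc) j` are summable at the `ff` fibres
(`RelInvPeriodisedComb.spr_bhKStepSh_Dsh`). -/
theorem summable_bhKStepSh_translate (x y : Fin (d + 1) → ℤ) (a b : Fin (d + 1)) :
    Summable fun m : Fin (d + 1) → ℤ => bhKStepSh d Lc (Dsh Lc) j x (translate (towerTorus Lc M (n + 1)) y m) (Sum.inl a) (Sum.inl b) :=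
  summable_translate_of_spr (towerTorus Lc M (n + 1)) (spr_bhKStepSh_Dsh j) x y a b

end Instance

/-! ## §3 (E3b) at the wrapper's torus Hessian kernel: the two conjugation letters GONE -/

section Wrapper

variable (Lc : ℕ) [NeZero Lc] (N n j : ℕ) (M : Fin (d + 1) → ℕ) [∀ μ, NeZero (M μ)] (lev : ℕ → ℕ)
  (ℓ : ℕ → Fin (d + 1) → Site (d + 1) → Bond (d + 1) → ℝ)
  (𝒽 : Fin (d + 1) → Site (d + 1) → MKer (d + 1) (Fib d))
  (cf : ℕ → Fin (d + 1) → Site (d + 1) → Fin (d + 1) → Site (d + 1) → ℝ) (w : ℕ → ℝ)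
  (hb : (k : ℕ) → (↥(pbox (towerTorus Lc M k)) × Fin (d + 1) → ℝ))
  {Cs : ℕ → ℝ} {δ : ℝ} (hLS : ∀ j, LocStencil (SLam N (cf j) 𝒽) (Cs j) δ) (hCs : ∀ j, 0 ≤ Cs j) (hδ : 0 < δ)
  (hℓ : ∀ i < n + 1, ∀ (μ : Fin (d + 1)) (y : Site (d + 1)) (g : Bond (d + 1)),
    ℓ i μ y g = stepScale d Lc (lev (n + 1 - i)) * ((Lc : ℝ) ^ (d + 1) * symLinKerAt (ctr (d + 1) Lc) Lc μ y g))
  {𝒦 : ℕ → MKer (d + 1) (Fin (d + 1))}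
  (h𝒦 : ∀ j ≤ n + 1, ∀ (β β' : Site (d + 1)) (b b' : Fin (d + 1)), 𝒦 j β β' b b'
    = ∑ a : Fin (d + 1), ∑ a' : Fin (d + 1), ∑' γ : Site (d + 1), ∑' γ' : Site (d + 1),
        compLinKer ℓ Lc (n + 1 - j) (b, β) (a, γ)
          * (w j * ∑ ā : ↥(pbox (towerTorus Lc M j)) × Fin (d + 1),
              hb j ā * SLam N (cf j) 𝒽 ā.2 (ā.1 : Site (d + 1)) γ γ' (Sum.inl a) (Sum.inl a'))
          * compLinKer ℓ Lc (n + 1 - j) (b', β') (a', γ'))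
  {𝒱 : MKer (d + 1) (Fin (d + 1))} (c : ℝ)
  (h𝒱 : ∀ (x y : Site (d + 1)) (a b : Fin (d + 1)), 𝒱 x y a b
    = (-2 * c) * (∑ b₀ : ↥(pbox (towerTorus Lc M (n + 1))) × Fin (d + 1), hb (n + 1) b₀ * wilsonA d b₀.2 (b₀.1 : Site (d + 1)) x y (Sum.inl a) (Sum.inl b))
      + ∑ j ∈ Finset.range (n + 1 + 1), 𝒦 j x y a b)
  (l : ↥(pbox (towerTorus Lc M (n + 1))) → ℝ)
include hLS hCs hδ hℓ h𝒦 h𝒱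

/-- [folklore] **`H'1f_eq_perF_dper_bhKStepSh` — (E3b) AT THE WRAPPER's TORUS HESSIAN KERNEL `K₀ := bhKStepSh d Lc (Dsh Lc) j` ON `T := towerTorus Lc M (n+1)`**,
for ANY lattice pre-image `λ̃` (`s`, letter `hs`, periodisation `S` with `hS`, restricting to `l` on the box: `hl`): the `hH'₁f`-shaped matrix equals
`perF T (dper T 𝒴)`, `𝒴 x y a b = c·(λ̃ x − λ̃ y)·K₀ x y (inl a) (inl b) + 𝒱 x y a b` — the letters `hK₀ ∕ hK₀s` of g38's theorem DISCHARGED (§2). -/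
theorem H'1f_eq_perF_dper_bhKStepSh (s : Site (d + 1) → ℝ) (hs : ∀ x : Site (d + 1), Summable fun m : Fin (d + 1) → ℤ => s (translate (towerTorus Lc M (n + 1)) x m))
    {S : Site (d + 1) → ℝ} (hS : ∀ x : Site (d + 1), S x = ∑' m : Fin (d + 1) → ℤ, s (translate (towerTorus Lc M (n + 1)) x m))
    (hl : ∀ r : ↥(pbox (towerTorus Lc M (n + 1))), l r = S (r : Site (d + 1)))
    {𝒳 : MKer (d + 1) (Fin (d + 1))}
    (h𝒳 : ∀ (x y : Site (d + 1)) (a b : Fin (d + 1)), 𝒳 x y a b = c * (s x - s y) * bhKStepSh d Lc (Dsh Lc) j x y (Sum.inl a) (Sum.inl b))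
    {𝒴 : MKer (d + 1) (Fin (d + 1))}
    (h𝒴 : ∀ (x y : Site (d + 1)) (a b : Fin (d + 1)), 𝒴 x y a b = c * (s x - s y) * bhKStepSh d Lc (Dsh Lc) j x y (Sum.inl a) (Sum.inl b) + 𝒱 x y a b)
    (hLc : 2 ≤ Lc) (rs : ℕ → (Fin (d + 1) → ℕ)) :
    -((-(c • Matrix.diagonal (fun b : ↥(pbox (towerTorus Lc M (n + 1))) × Fin (d + 1) => l b.1)))ᵀ
          * (perF (towerTorus Lc M (n + 1)) (bhKStepSh d Lc (Dsh Lc) j)).submatrix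
              (fun b : ↥(pbox (towerTorus Lc M (n + 1))) × Fin (d + 1) => ((b.1, Sum.inl b.2) : Idx (towerTorus Lc M (n + 1)) (Fib d)))
              (fun b : ↥(pbox (towerTorus Lc M (n + 1))) × Fin (d + 1) => ((b.1, Sum.inl b.2) : Idx (towerTorus Lc M (n + 1)) (Fib d))))
      + ((-2 * c) • ∑ b₀ : ↥(pbox (towerTorus Lc M (n + 1))) × Fin (d + 1), hb (n + 1) b₀ •
          (perF (towerTorus Lc M (n + 1)) (dper (towerTorus Lc M (n + 1)) (wilsonA d b₀.2 (b₀.1 : Site (d + 1))))).submatrix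
            (fun p : ↥(pbox (towerTorus Lc M (n + 1))) × Fin (d + 1) => ((p.1, Sum.inl p.2) : Idx (towerTorus Lc M (n + 1)) (Fib d)))
            (fun p : ↥(pbox (towerTorus Lc M (n + 1))) × Fin (d + 1) => ((p.1, Sum.inl p.2) : Idx (towerTorus Lc M (n + 1)) (Fib d)))
        + w (n + 1) • ∑ ā : ↥(pbox (towerTorus Lc M (n + 1))) × Fin (d + 1), hb (n + 1) ā •
          (perF (towerTorus Lc M (n + 1)) (dper (towerTorus Lc M (n + 1)) (SLam N (cf (n + 1)) 𝒽 ā.2 (ā.1 : Site (d + 1))))).submatrix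
            (fun p : ↥(pbox (towerTorus Lc M (n + 1))) × Fin (d + 1) => ((p.1, Sum.inl p.2) : Idx (towerTorus Lc M (n + 1)) (Fib d)))
            (fun p : ↥(pbox (towerTorus Lc M (n + 1))) × Fin (d + 1) => ((p.1, Sum.inl p.2) : Idx (towerTorus Lc M (n + 1)) (Fib d)))
        + compSumSym Lc (onTowerFamily Lc M (fun k => w k • ∑ ā : ↥(pbox (towerTorus Lc M k)) × Fin (d + 1), hb k ā •
          (perF (towerTorus Lc M k) (dper (towerTorus Lc M k) (SLam N (cf k) 𝒽 ā.2 (ā.1 : Site (d + 1))))).submatrix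
            (fun p : ↥(pbox (towerTorus Lc M k)) × Fin (d + 1) => ((p.1, Sum.inl p.2) : Idx (towerTorus Lc M k) (Fib d)))
            (fun p : ↥(pbox (towerTorus Lc M k)) × Fin (d + 1) => ((p.1, Sum.inl p.2) : Idx (towerTorus Lc M k) (Fib d))))) M lev rs (n + 1))
      + (perF (towerTorus Lc M (n + 1)) (bhKStepSh d Lc (Dsh Lc) j)).submatrix
            (fun b : ↥(pbox (towerTorus Lc M (n + 1))) × Fin (d + 1) => ((b.1, Sum.inl b.2) : Idx (towerTorus Lc M (n + 1)) (Fib d)))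
            (fun b : ↥(pbox (towerTorus Lc M (n + 1))) × Fin (d + 1) => ((b.1, Sum.inl b.2) : Idx (towerTorus Lc M (n + 1)) (Fib d)))
          * (-(c • Matrix.diagonal (fun b : ↥(pbox (towerTorus Lc M (n + 1))) × Fin (d + 1) => l b.1)))
      = perF (towerTorus Lc M (n + 1)) (dper (towerTorus Lc M (n + 1)) 𝒴) :=
  H'1f_eq_perF_dper Lc N (n + 1) M lev ℓ 𝒽 cf w hb hLS hCs hδ hℓ h𝒦 c h𝒱 (bhKStepSh d Lc (Dsh Lc) j) (bhKStepSh_translate_invariant Lc M n j)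
    (summable_bhKStepSh_translate Lc M n j) s hs hS l hl h𝒳 h𝒴 hLc rs

/-- [folklore] **`H'1f_eq_perF_dper_bhKStepSh_boxLift` — (E3b) AT THE WRAPPER's OBJECTS WITH NO LETTER LEFT**: `K₀ := bhKStepSh d Lc (Dsh Lc) j`, `T := towerTorus Lc M (n+1)`,
ANY torus direction `l`, the CANONICAL pre-image (box lift `λ̃ x := [x ∈ pbox T]·l x`, `hsl`), `𝒴` DISPLAYED (`h𝒴`); data = g37's display (`hℓ hLS hCs hδ h𝒦 h𝒱`) and `2 ≤ Lc`. -/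
theorem H'1f_eq_perF_dper_bhKStepSh_boxLift (s : Site (d + 1) → ℝ)
    (hsl : ∀ x : Site (d + 1), s x = if h : x ∈ pbox (towerTorus Lc M (n + 1)) then l ⟨x, h⟩ else 0)
    {𝒴 : MKer (d + 1) (Fin (d + 1))}
    (h𝒴 : ∀ (x y : Site (d + 1)) (a b : Fin (d + 1)), 𝒴 x y a b = c * (s x - s y) * bhKStepSh d Lc (Dsh Lc) j x y (Sum.inl a) (Sum.inl b) + 𝒱 x y a b)
    (hLc : 2 ≤ Lc) (rs : ℕ → (Fin (d + 1) → ℕ)) :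
    -((-(c • Matrix.diagonal (fun b : ↥(pbox (towerTorus Lc M (n + 1))) × Fin (d + 1) => l b.1)))ᵀ
          * (perF (towerTorus Lc M (n + 1)) (bhKStepSh d Lc (Dsh Lc) j)).submatrix
              (fun b : ↥(pbox (towerTorus Lc M (n + 1))) × Fin (d + 1) => ((b.1, Sum.inl b.2) : Idx (towerTorus Lc M (n + 1)) (Fib d)))
              (fun b : ↥(pbox (towerTorus Lc M (n + 1))) × Fin (d + 1) => ((b.1, Sum.inl b.2) : Idx (towerTorus Lc M (n + 1)) (Fib d))))
      + ((-2 * c) • ∑ b₀ : ↥(pbox (towerTorus Lc M (n + 1))) × Fin (d + 1), hb (n + 1) b₀ •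
          (perF (towerTorus Lc M (n + 1)) (dper (towerTorus Lc M (n + 1)) (wilsonA d b₀.2 (b₀.1 : Site (d + 1))))).submatrix
            (fun p : ↥(pbox (towerTorus Lc M (n + 1))) × Fin (d + 1) => ((p.1, Sum.inl p.2) : Idx (towerTorus Lc M (n + 1)) (Fib d)))
            (fun p : ↥(pbox (towerTorus Lc M (n + 1))) × Fin (d + 1) => ((p.1, Sum.inl p.2) : Idx (towerTorus Lc M (n + 1)) (Fib d)))
        + w (n + 1) • ∑ ā : ↥(pbox (towerTorus Lc M (n + 1))) × Fin (d + 1), hb (n + 1) ā •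
          (perF (towerTorus Lc M (n + 1)) (dper (towerTorus Lc M (n + 1)) (SLam N (cf (n + 1)) 𝒽 ā.2 (ā.1 : Site (d + 1))))).submatrix
            (fun p : ↥(pbox (towerTorus Lc M (n + 1))) × Fin (d + 1) => ((p.1, Sum.inl p.2) : Idx (towerTorus Lc M (n + 1)) (Fib d)))
            (fun p : ↥(pbox (towerTorus Lc M (n + 1))) × Fin (d + 1) => ((p.1, Sum.inl p.2) : Idx (towerTorus Lc M (n + 1)) (Fib d)))
        + compSumSym Lc (onTowerFamily Lc M (fun k => w k • ∑ ā : ↥(pbox (towerTorus Lc M k)) × Fin (d + 1), hb k ā •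
          (perF (towerTorus Lc M k) (dper (towerTorus Lc M k) (SLam N (cf k) 𝒽 ā.2 (ā.1 : Site (d + 1))))).submatrix
            (fun p : ↥(pbox (towerTorus Lc M k)) × Fin (d + 1) => ((p.1, Sum.inl p.2) : Idx (towerTorus Lc M k) (Fib d)))
            (fun p : ↥(pbox (towerTorus Lc M k)) × Fin (d + 1) => ((p.1, Sum.inl p.2) : Idx (towerTorus Lc M k) (Fib d))))) M lev rs (n + 1))
      + (perF (towerTorus Lc M (n + 1)) (bhKStepSh d Lc (Dsh Lc) j)).submatrix
            (fun b : ↥(pbox (towerTorus Lc M (n + 1))) × Fin (d + 1) => ((b.1, Sum.inl b.2) : Idx (towerTorus Lc M (n + 1)) (Fib d)))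
            (fun b : ↥(pbox (towerTorus Lc M (n + 1))) × Fin (d + 1) => ((b.1, Sum.inl b.2) : Idx (towerTorus Lc M (n + 1)) (Fib d)))
          * (-(c • Matrix.diagonal (fun b : ↥(pbox (towerTorus Lc M (n + 1))) × Fin (d + 1) => l b.1)))
      = perF (towerTorus Lc M (n + 1)) (dper (towerTorus Lc M (n + 1)) 𝒴) :=
  H'1f_eq_perF_dper_boxLift Lc N (n + 1) M lev ℓ 𝒽 cf w hb hLS hCs hδ hℓ h𝒦 c h𝒱 (bhKStepSh d Lc (Dsh Lc) j) (bhKStepSh_translate_invariant Lc M n j)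
    (summable_bhKStepSh_translate Lc M n j) l s hsl h𝒴 hLc rs

end Wrapper

end Summit.QuantumFields.BalabanUV.Beta.FP.TorusHSideJetConjLetters

end
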